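import Mathlib
import HarnessLib
import HarnessLib.Audit
import Summits.CriticalPhenomena.Statement

/-!
Route: PercNonProliferation

# Route PercNonProliferation — bounded number of annulus-spanning box-clusters at p_c plus free-box
sparsity force theta(p_c)=0 by a density count

It suffices to show X = FreeBoxSparse ∧ NonProliferation (card
CriticalPhenomena/PercolationContinuityZ3/nonproliferation-is-enough, absorbing the retired
duplicates jump-forces-proliferation and jump-forces-spanning-cluster-proliferation). Work at p =
p_c(ℤ³) in the free box B(2n) = [−2n,2n]³ with its inner box B(n); a box-cluster is a component of
the open subgraph INDUCED on B(2n); call it spanning if it meets B(n) and the inner vertex boundary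
∂⁻B(2n); N_n := number of spanning box-clusters (typed through representatives: N_n ≤ M iff there
are no M+1 points of B(n), pairwise not joined inside B(2n), each joined inside B(2n) to ∂⁻B(2n)).
NonProliferation (Coniglio's O(1), the weakest crossing-type input we know): ∃ M, c > 0 with
P_{p_c}(N_n ≤ M) ≥ c for infinitely many n — it tolerates P(B(n) ↔ ∂⁻B(2n)) → 1 and forbids only
that spanning clusters MULTIPLY (the verbatim negation of Aizenman's d > 6 picture, ≈ n^{d−6}
spanning clusters).
FreeBoxSparse (the free-box 'folklore', typed as a pair average): FA₂(n) := |B(n)|⁻² Σ_{x,y∈B(n)}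
P_{p_c}(x ↔ y inside B(n)) → 0, equivalently |K_max^free(B(n))|/|B(n)| → 0 in probability (no
free-boundary giant at p_c); implied by θ(p_c) = 0, so its only failure mode is a jump world with
in-box giants.
Assembly (density count, three lines): if θ(p_c) = θ* > 0, every percolating x ∈ B(n) lies in a
spanning box-cluster (an infinite open path exits B(2n) through ∂⁻B(2n)), so with V_n := #{x ∈ B(n)
: x ↔ ∞} and S_n := #{(x,y) ∈ B(n)² : x ↔ y inside B(2n)} Cauchy–Schwarz over the ≤ N_n classes
gives V_n² ≤ N_n · S_n pointwise; V_n ≥ θ*|B(n)|/2 w.h.p. (L² ergodic theorem for 1{x↔∞}), S_n ≤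
δ|B(n)|² w.h.p. (FreeBoxSparse + Markov), hence N_n ≥ θ*²/(4δ) → ∞ in probability, contradicting
NonProliferation. A second, ergodic-free assembly of the polynomial pair (r4, r5) is filed as
support PolynomialAssembly: (θ|B(n)|)² ≤ E[N_n]·E[S_n] for every p, n (free-box cousin of the ADS
density bound) with the BK cap E[N_n] ≤ 1/P_{p_c}(B(n) ↮ ∂⁻B(2n)).
Lean: `(Filter.Tendsto (fun n : ℕ => (∑ x ∈ Literature.Probability.LatticeModels.box 3 n, ∑ y ∈
Literature.Probability.LatticeModels.box 3 n, (Literature.Probability.Percolation.bondPercolation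
(Literature.Probability.LatticeModels.zdGraph 3) (Literature.Probability.Percolation.criticalProbI
3)).real (Literature.Probability.Percolation.openConnIn ↑(Literature.Probability.LatticeModels.box 3
n) x y)) / ((Literature.Probability.LatticeModels.box 3 n).card : ℝ) ^ 2) Filter.atTop (nhds 0)) ∧
(∃ (M : ℕ) (c : ℝ), 0 < c ∧ ∃ᶠ n : ℕ in Filter.atTop, c ≤
(Literature.Probability.Percolation.bondPercolation (Literature.Probability.LatticeModels.zdGraph 3)
(Literature.Probability.Percolation.criticalProbI 3)).real {ω | ¬ ∃ x : Fin (M + 1) →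
Literature.Probability.LatticeModels.Site 3, (∀ i, x i ∈ Literature.Probability.LatticeModels.box 3
n) ∧ (∀ i, ∃ y ∈ Literature.Probability.LatticeModels.innerBoundary
(Literature.Probability.LatticeModels.zdGraph 3) (Literature.Probability.LatticeModels.box 3 (2 *
n)), ω ∈ Literature.Probability.Percolation.openConnIn ↑(Literature.Probability.LatticeModels.box 3
(2 * n)) (x i) y) ∧ ∀ i j, i ≠ j → ω ∉ Literature.Probability.Percolation.openConnIn
↑(Literature.Probability.LatticeModels.box 3 (2 * n)) (x i) (x j)})`

## Assembly
Given the two supports as hypotheses the assembly is measure-theoretic bookkeeping: suppose θ :=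
theta (zdGraph 3) 0 (criticalProbI 3) ≠ 0, so θ > 0; NonProliferation gives M, c and infinitely many
n with P(G_n) ≥ c, G_n = {N_n ≤ M}; DensityWhp at p_c gives P(V_n ≥ θ|B(n)|/2) → 1; FreeBoxSparse at
index 2n, monotonicity of the pair sum in the box and |B(2n)| ≤ 8|B(n)| give E S_n = o(|B(n)|²), so
by Markov P(S_n > δ|B(n)|²) → 0 with δ := θ²/(8(M+1)); for a large n of the subsequence the three
events and the full-measure event ω ⊆ E(ℤ³) (setBernoulli_ae_subset) intersect (measurability of
openConnIn / percolatesAt events is in tree), and on the intersection SpanningPiecesCount gives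
θ²|B(n)|²/4 ≤ V_n² ≤ M S_n ≤ M δ |B(n)|² < θ²|B(n)|²/4 — contradiction; hence θ(p_c) = 0, which is
PercolationContinuityZ3 (= PercolationContinuity 3) by Iff.rfl.

Rationale: WHY THIS LINE. A first-order transition on ℤ³ would make ℤ³ look seven-dimensional: given sparse
free boxes, θ(p_c) > 0 forces the number of disjoint annulus-spanning clusters to diverge — exactly
the phenomenon Aizenman1997 (Thm 4; HeydenreichVanDerHofstad2017 §13.6) PROVES for d > 6 and which
hyperscaling (Coniglio; BorgsChayesKestenSpencer1999; Aizenman1997 Thm 3 in d = 2 with tail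
e^{−αk²}; numerics Sen 1996 doi:10.1142/s0129183196000508, Shchur 2000
doi:10.1007/978-3-642-59689-6_12) forbids for d < 6; the mechanism is one Cauchy–Schwarz over
spanning pieces plus the density of the infinite cluster, with no renormalisation, sprinkling,
gluing or surface duality. What is imported: incipient-spanning-cluster counting from the
hyperscaling literature (statistical physics of d_c = 6) as the HYPOTHESIS, the
Aizenman–Duminil-Copin–Sidoravicius Cauchy–Schwarz density skeleton (in tree:
Literature.Probability.Percolation.sq_sum_measureReal_percolatesAt_le) transplanted from bulk to
FREE boxes at the price of the factor N_n, and van den Berg–Kesten/Reimer disjoint occurrence (in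
tree: bk_finitary_list) for the polynomial pair. Versus the open routes: PercAnnulusCrossing needs
X_B = 'crossings FAIL with probability ≥ c' (BCKS postulate; implies NonProliferation with M = 0)
and assembles through CrossingTendstoOne, whereas NonProliferation allows crossing probability → 1
and is closed by counting; PercFiniteBoxLRO/PercTwoPointDecay attack connectivities, not cluster
numbers; the negatives index (one SAW statement) is untouched. Honest label: r3 is the shared
free-box input now diagnosed in-house as a branch hypothesis (cards free-box-shattering-is-a-branch,
free-box-folklore-knife-edge: true at the corner by BGN, unproved at the centre, no cheap proof),
and r2 has no 3-D engine yet (Cerf2015 counts distinct clusters only at aspect ratio n^42) — the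
firm content is the relocation of the needed d < 6 input from 'crossings fail' to 'spanning clusters
do not multiply', plus two provable-now inequalities.

RANKED CRUXES. #2 NonProliferation (crux) — at p_c(ℤ³) there are M ∈ ℕ and c > 0 such that for
infinitely many n, with probability ≥ c at most M distinct clusters of the open subgraph induced on
B(2n) meet both B(n) and ∂⁻B(2n) (card item r2, positive-probability form; the '1−ε tightness' and
bounded-mean forms imply it). [difficulty: open-problem] (why it might fail: False iff critical
annulus-spanning clusters proliferate in d=3: PROVED for d>6 (Aizenman1997 Thm 4, ~n^(d-6)
clusters), forced in a jump world with sparse free boxes (this assembly); d=3 evidence numerical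
only (Sen 1996, Shchur 2000); no tool counts distinct crossers at aspect ratio 2 (Cerf2015).)
[Aizenman1997, BorgsChayesKestenSpencer1999, Cerf2015, doi:10.1214/15-aop1049,
HeydenreichVanDerHofstad2017, doi:10.1142/s0129183196000508, doi:10.1007/978-3-642-59689-6_12,
VandenbergVanengelenburg2022]
#3 FreeBoxSparse (crux) — the pair-averaged free-box connectivity at p_c(ℤ³) vanishes: |B(n)|⁻²
Σ_{x,y∈B(n)} P_{p_c}(x ↔ y inside B(n)) → 0 (card item r3 in L² form = the retired cards'
J1/W1-qualitative; equivalent to |K_max^free(B(n))|/|B(n)| → 0 in probability and to Hutchcroft's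
centred folklore E|K_{B(r)}(0)| = o(r³); shared input of cards box-hyperscaling-gluing,
hollow-cells-inbox-shattering, critical-cluster-threshold-one). [difficulty: L] (why it might fail:
Implied by theta(p_c)=0, so false only in a jump world with free-box GIANTS (monolithic branch =
Cerf's linear-scale LRO at p_c). Hutchcroft2022 p.5 calls it folklore 'in every d>=2' but no proof
is located; lowest-point/BK/BGN attempts miss by exponent 0.05 (card free-box-folklore-knife-edge).)
[Hutchcroft2022, arXiv:2202.07634, Hutchcroft2021, arXiv:2008.11197, Grimmett1999, Cerf2015]
#4 SubpolynomialBlocking (crux) — the critical annulus-blocking probability decays slower than any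
power: for every s > 0, eventually P_{p_c}(no open path inside B(2n) from B(n) to ∂⁻B(2n)) ≥ n^{−s}
(absorbed criterion C-b of jump-forces-spanning-cluster-proliferation; strictly weaker than
PercAnnulusCrossing.CritAnnulusNonCrossing, which asks ≥ c; by BK it caps E[N_n] ≤ n^s).
[difficulty: open-problem] (why it might fail: False iff P_pc(B(n) not joined to dB(2n)) <= n^-s on
a subsequence: the case when spanning clusters proliferate (d>6: blocking prob -> 0, Aizenman1997,
BCKS1999). In d=3 numerics give a constant (wrapping ratios, arXiv:1302.0421) but every RSW-type
lower bound is open (BenjaminiKalai2018 p.71).) [Aizenman1997, BorgsChayesKestenSpencer1999,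
arXiv:1302.0421, BenjaminiKalai2018, NewmanTassionWu2017]
#5 FreeBoxPowerSaving (crux) — a power saving for the free-box pair average at p_c(ℤ³): ∃ a > 0, C
with |B(n)|⁻² Σ_{x,y∈B(n)} P_{p_c}(x ↔ y inside B(n)) ≤ C n^{−a} for n ≥ 1 (absorbed W1 of
jump-forces-spanning-cluster-proliferation; prediction a = 1+η ≈ 0.95; strengthens FreeBoxSparse and
is weaker than PercTwoPointDecay's bulk X_A). [deps: FreeBoxSparse] [difficulty: L] (why it might
fail: Stronger than FreeBoxSparse (rate a>0, predicted a=1+eta=0.95): false in the monolithic jump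
branch; as a proof target the visible route (lowest point + BK + BGN half-space masses) needs
x_s+x_b>3/2 while numerics give 1.45 (card free-box-folklore-knife-edge; Deng-Blote x_s=0.975).)
[Hutchcroft2022, arXiv:2202.07634, doi:10.1103/physreve.71.016117, arXiv:1810.03750,
arXiv:1302.0421]
#9 SpanningPiecesCount (support) — deterministic Cauchy–Schwarz over spanning pieces: for a
configuration using lattice edges only, if no M+1 points of B(n) are pairwise unjoined inside B(2n)
and each joined inside B(2n) to ∂⁻B(2n), then (#{x ∈ B(n) : |C(x)| = ∞})² ≤ M · #{(x,y) ∈ B(n)² : x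
↔ y inside B(2n)} (every percolating point of B(n) is a spanning representative since an infinite
open path leaves B(2n) through ∂⁻B(2n); percolating points fall into ≤ M classes; (Σ_r |P_r|)² ≤ M
Σ_r |P_r|²). [difficulty: provable-now] [AizenmanDuminilCopinSidoraviciusCMP2015, Aizenman1997]
#9 DensityWhp (support) — lower half of the L² ergodic theorem for the density of percolating sites,
every p: P_p(#{x ∈ B(n) : |C(x)| = ∞} ≥ θ(p)|B(n)|/2) → 1 (E V_n = θ|B(n)| by shift invariance,
bondPercolation_real_preimage_shift; Var V_n = o(|B(n)|²) because Cov(1{x↔∞},1{y↔∞}) ≤ 4(θ_k − θ)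
for |x−y|_∞ > 2k+1 via the independent local events {x ↔ x+∂B(k)} and θ_k ↓ θ; Chebyshev).
[difficulty: provable-now] [Grimmett1999, AizenmanDuminilCopinSidoraviciusCMP2015]
#9 MeanCauchySchwarz (support) — the free-box cousin of the ADS density bound, every p and n:
(θ(p)|B(n)|)² ≤ E_p[N_n] · E_p[S_n], where E_p[N_n] = Σ_{k<|B(n)|} P_p(∃ k+1 points of B(n) pairwise
unjoined inside B(2n), each joined inside B(2n) to ∂⁻B(2n)) and E_p[S_n] = Σ_{x,y∈B(n)} P_p(x ↔ y
inside B(2n)) (pointwise V² ≤ N·S a.s. as in SpanningPiecesCount, then E V ≤ (E[V²/S])^{1/2} (E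
S)^{1/2} and V²/S ≤ N; no FKG, no uniqueness, no ergodic theorem; absorbed (W1) of
jump-forces-spanning-cluster-proliferation). [difficulty: provable-now]
[AizenmanDuminilCopinSidoraviciusCMP2015, Aizenman1997]
#9 SpanningBKCap (support) — BK cap on the spanning count, every p, k, n: P_p(∃ k+1 points of B(n)
pairwise unjoined inside B(2n), each joined inside B(2n) to ∂⁻B(2n)) ≤ P_p(B(n) ↔ ∂⁻B(2n) inside
B(2n))^{k+1} (distinct box-clusters carry vertex-disjoint crossing paths = pairwise disjoint
witnesses of the increasing finitary crossing event;
Literature.Probability.Percolation.bk_finitary_list with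
mem_disjointOccurrenceList_of_pairwise_disjoint). [difficulty: provable-now] [Grimmett1999,
ReimerCPC2000, Aizenman1997]
#9 PolynomialAssembly (support) — glue of the polynomial pair: MeanCauchySchwarz → SpanningBKCap →
FreeBoxPowerSaving → SubpolynomialBlocking → θ(p_c) = 0 (at p_c with s := a/2: E[N_n] ≤ Σ_k
(1−u_n)^{k+1} ≤ 1/u_n ≤ n^{a/2}, E[S_n] ≤ Σ_{x,y∈B(2n)} P(x ↔ y inside B(2n)) ≤ 64 C 2^{−a} n^{−a}
|B(n)|², so θ(p_c)² ≤ 64 C n^{−a/2} → 0). [difficulty: provable-now] [BorgsChayesKestenSpencer1999,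
Aizenman1997]

TWO-LAYER PLAN. Foreseen glued splits (none filed now; k ≤ 3, depth 1): NonProliferation ⇐
ContactSurgery → PivotalSparsity → NonProliferation (engine E1 of the card: k distinct crossers
either have pairwise disjoint closed edge-boundaries or two share a closed pivotal-type edge;
AKN/GGR local modification merges them with multiplicity = a pivotal count,
AizenmanKestenNewmanCMP1987) or NonProliferation ⇐ LinearTwoCrosserBound → FKGContinuation →
NonProliferation (engine E2: push Cerf2015 Thm 1.2 from aspect ratio n^42 towards a constant; local
two-distinct-cluster bounds of AKN type, Cerf2015 Thm 1.1 and Duminil-Copin–Ioffe–Velenik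
doi:10.1214/15-aop1049, are the available contact-counting inputs); FreeBoxSparse ⇐ NoFreeGiant →
FreeBoxSparse with NoFreeGiant := ∀δ, P_{p_c}(|K_max^free(B(n))| ≥ δ|B(n)|) → 0 (two-line
equivalence; Hutchcroft2021 Thm 2.2 universal tightness converts 'giant with probability δ' into
'giant w.h.p.', handing the negation to PercFiniteBoxLRO's R and the dense-piece-uniqueness
programme). PolynomialAssembly is already the glue of (FreeBoxPowerSaving, SubpolynomialBlocking).

KILL CRITERIA. refuted:NonProliferation (a proof that P_{p_c}(N_n ≤ M) → 0 for every M on ℤ³) closes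
the route outright — and, with FreeBoxSparse, would itself be news (the d > 6 signature in d = 3); a
cheap proof that NonProliferation ⇒ CritAnnulusNonCrossing (X_B) makes r2 no weaker than
PercAnnulusCrossing's crux: close superseded by route-CriticalPhenomena-PercAnnulusCrossing and
attach r2 there. ¬FreeBoxSparse is θ(p_c) > 0 with free-box giants, i.e. a refutation of the
CONJUNCT (summit-level event, not a route event); a proof that a jump forces free-box giants (jump ⇒
¬FreeBoxSparse) makes r3 equivalent to the target — close (crux restates target) and hand the
monolithic branch to PercFiniteBoxLRO; conversely a proof that a jump forces shattering makes r3 a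
theorem and the route reduces to r2 alone. refuted:SubpolynomialBlocking or
refuted:FreeBoxPowerSaving kills only the polynomial pair (drop r4/r5 and PolynomialAssembly; main
line intact). Mooted by: CritAnnulusNonCrossing proved (gives r2 with M = 0 and the conjunct
directly); PercTwoPointDecay's X_A proved (gives r5 and the conjunct).

NOT DECOMPOSED YET. The engines for r2 (E1 contact surgery / pivotal sparsity, E2
linear-aspect-ratio two-crosser bounds with FKG continuation) — no typed statement until a
pivotal-count or linear two-arm notion is fixed; the mixing lemma inside DensityWhp and the
class-partition bookkeeping inside SpanningPiecesCount/MeanCauchySchwarz (provers' helpers via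
--supports, never items); the equivalences FA₂ → 0 ⟺ |K_max^free|/|B| → 0 in probability ⟺
Hutchcroft's centred form (provers bridge whichever form a sibling route files; dedup by signature
otherwise); the '1−ε tightness' and bounded-mean strengthenings of r2 (they imply r2; not separate
items); the marginal quantitative variant E3 of the card (shattering rate a plus crossing volume b
with a + b > 1: numerically a + b = 1 exactly, so deliberately NOT filed); q > 1 / free
random-cluster and other lattices.

CHEAPEST FALSIFIER. Monte Carlo of the law of N_n at p_c(ℤ³, bond) = 0.2488126 for n = 8…64
(distinct in-box clusters of B(2n) joining B(n) to ∂⁻B(2n); ~1 CPU-day, shared with card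
box-hyperscaling-gluing): a distribution drifting upward with n kills r2's plausibility, while P(N_n
≤ 3) ≥ 0.5 at all n (the published 3-D spanning-cluster multiplicities: Sen 1996
doi:10.1142/s0129183196000508, Shchur 2000 doi:10.1007/978-3-642-59689-6_12 — L-independent
probabilities decaying fast in k) supports it; same run measures FA₂(n) (predicted ≍ n^−0.95,
deciding the sign of r5's exponent) and the blocking probability u_n (predicted constant, r4). Not
run here (plancard mode, no kit budget in payload). Theory-side cheapest check, done on paper in
this session: the pointwise inequality V² ≤ N·S needs ω ⊆ E(ℤ³) (else a long non-lattice open edge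
lets 0 ↔ ∞ without an in-box crossing) — the hypothesis was added to SpanningPiecesCount; and the d
> 6 sanity check of MeanCauchySchwarz: E N ~ n^{d−6}, E S ~ n^{d+2}·n^{d}/n^{d} gives θ² ≲
n^{−4}·const, consistent.

NUMBERS. p_c(ℤ³ bond) = 0.2488126(5); fractal dimension d_f = 2.523 so β/ν = 3 − d_f = 0.477 and η =
−0.046 (arXiv:1302.0421: wrapping probability R_c^(x) = 0.25780(6), β/ν = 0.47705(15)); predicted
FA₂(n) ≍ n^−(1+η) = n^−0.954 (r5 with a ≈ 0.95, r3 with room); predicted u_n → u* ∈ (0,1) (r4 with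
room; X_B would be u* > 0); spanning-cluster number: d = 2 P(N ≥ k) ≈ e^{−αk²} (Aizenman1997 Thm 3;
Cardy 1998 doi:10.1088/0305-4470/31/5/003 exact), d > 6 N ≈ n^{d−6} and free largest cluster ≈ n^4
(Aizenman1997 Thm 4–5; HeydenreichVanDerHofstad2017 Thm 13.22, §13.6 p.194), d = 3 numerically O(1)
with fast-decaying multiplicities (Sen 1996; Shchur 2000). Unconditional caps in d = 3: E N_n =
o(n²) only (BGN half-space count / zero max-flow), E N_n ≤ (1 − u_n)/u_n (BK). Items at open: 10 (4
cruxes, 5 supports, 1 assembly).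

DEFINITION REQUESTS. None needed: 'at most M spanning box-clusters' is typed through representatives
over openConnIn ↑(box 3 (2n)) and innerBoundary (zdGraph 3) (box 3 (2n)); the bulk left–right count
Literature.Barriers.CriticalPhenomena.numSpanningClusters exists but is the wrong geometry
(annulus/free is what the density count needs). Cite fact wanted later (not load-bearing):
Hutchcroft2021 Thm 2.2 (arXiv:2008.11197, universal tightness of |K_max| on any finite graph) as a
Literature fact, for the NoFreeGiant ⟺ FreeBoxSparse bridge.

Novelty: Searches (2026-08-15): `lit search --hybrid "number of spanning clusters critical percolation three
dimensions tightness"` (12 held docs; read HeydenreichVanDerHofstad2017 pp.193–194 = §13.6/Thm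
13.22: Aizenman's n^(d−6) spanning clusters and n^4 free largest cluster for d ≥ 11); `lit vsearch`
of the thesis in prose (10 held books, nothing beyond Grimmett/HvdH/BR06); `lit search --source
crossref "incipient spanning clusters"` (15: Aizenman1997, Aizenman 1998 IMA
doi:10.1007/978-1-4612-1728-2_1, Cardy 1998, Shchur–Kosyakov 1997/98, Shchur 2000
doi:10.1007/978-3-642-59689-6_12) and `"non-uniqueness of spanning clusters two to five dimensions"`
(Sen 1996 doi:10.1142/s0129183196000508, Sen–Aharony 1997); `lit search --source
zbmath|openalex|arxiv|s2` (0 / HTTP 429 this session); `lit galaxy search "number of spanning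
clusters" --star all` and `"incipient spanning clusters" --star all` (galaxyd saturated twice, > 90
s queue — refuter please re-run the --star all sweep), `lit galaxy search "spanning clusters" --star
pdf` (12 hits: relevant only pdf:967867560 = Duminil-Copin–Ioffe–Velenik AoP 2016
doi:10.1214/15-aop1049, quantitative Burton–Keane = bounds on two DISTINCT clusters from the
endpoints of an edge to distance n under FKG/finite energy — an engine-side input for r2, abstract
read, full read queued out; and pdf:-8059187648857658420 = Heydenreich–van der Hofstad
arXiv:math/0512522, whose §1.3 summarises the BCKS postulates); `ledger negatives --problem
CriticalPhenomena` (  [refs: 10.1007/978-1-4612-1728-2_1, 10.1007/978-3-642-59689-6_12, 10.1142/s0129183196000508, 10.1214/15-aop1049, math/0512522, cond-mat/9609240, doi:10.1007/978-1-4612-1728-2_1, doi:10.1007/978-3-642-59689-6_12, doi:10.1142/s0129183196000508, doi:10.1214/15-aop1049, HeydenreichVanDerHofstad2017, Aizenman1997, Hutchcroft2022, BorgsChayesKestenSpencer1999, AizenmanDuminilCopinSidoraviciusCMP2015, Hutchcrof]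

Barriers (technique_class: crossing-cluster-tightness, density-count): - technique_class: crossing-cluster-tightness, density-count
- Literature.Barriers.CriticalPhenomena.SpanningClustersAboveSix: APPLIES maximally and is embraced
— its technique_class names 'tightness of the number N_L of spanning clusters' as an input false for
d > 6; r2 (and r4) ARE that input, so every proof of them must use d = 3 < 6 (hyperscaling side:
pivotal sparsity, contact exponents, RSW-type seeds); the assembly and the supports are
dimension-free and correctly give nothing above six (there E N ~ n^(d−6) balances E S ~ n^(d+2));
free/annulus vs bulk/left-right geometry is covered by the barrier's scope_caveats (Aizenman1997 §5
prose, N_Free ≥ N_Bulk).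
- Literature.Barriers.CriticalPhenomena.TransverseCrossingsNeedNotMeet: not engaged — clusters are
COUNTED, never glued; no crossing is asked to meet another (engaged only inside the foreseen engine
E2's FKG continuation, recorded as its gap).
- Literature.Barriers.CriticalPhenomena.SprinklingRenormalisation: evaded — static counting at the
single parameter p_c, no blocks, no p + η; it bites only on the COMPLEMENT of r3 (the monolithic
branch, whose killer is Cerf's same-p renormalisation R in route PercFiniteBoxLRO), which this route
deliberately does not claim.
- Literature.Barriers.CriticalPhenomena.RandomClusterFirstOrder: the count is q-general but the PAIR
(r2, r3) is not jointly available where a first-order transition is a theorem: for WIRED FK with q >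
Q on ℤ³ at p_c(q), r2 holds (one ordered giant) and r3 FAI

Novelty grade: new-combination — refuter gen-2 (rreview 10c13a27-g2, 2026-08-15): new-combination = (A) spanning-cluster tightness as INPUT (Aizenman1997 Thms 3-4, BCKS1999; r2 is the weakened form: count <= M w.p. >= c on a subsequence, compatible with crossing prob -> 1) x (B) ADS2015 Cauchy-Schwarz density bound moved from bulk  (refuter refuter-rreview-route-CriticalPhenomena--10c13a27-g2-0, 2026-08-15T14:47:34Z; prior: Aizenman1997 doi:10.1016/s0550-3213(96)00626-8 Thm 3 (d=2 tightness of spanning-cluster number) / Thm 4 (d>6 proliferation) = Barriers.SpanningClustersAboveSix, BorgsChayesKestenSpencer1999 (crossing probabilities bounded away from 0 and 1 => hyperscaling, tight N_L; an X_B-type postulate stronger than r2), AizenmanDuminilCopinSidoraviciusCMP2015 proof of Thm 3.1 (bulk Cauchy-Schwarz density bound)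

sub-problem: PercolationContinuityZ3 · status: open · opened planner-plancard-CriticalPhenomena-Percolatio-156765df-0 2026-08-15T11:34:17Z · rev 3 · ledger route-CriticalPhenomena-PercNonProliferation
GENERATED by the gate from the ledger (D-0016/17). Provers cite these decls: `theorem foo : Summit.CriticalPhenomena.PercolationContinuityZ3.Theses.PercNonProliferation.<Decl> := …` in Summits/CriticalPhenomena/PercolationContinuityZ3/Theorems/<Name>.lean.
-/

namespace Summit.CriticalPhenomena.PercolationContinuityZ3.Theses.PercNonProliferation

open scoped BigOperators Topology Manifold Classical MeasureTheory ProbabilityTheory Matrix InnerProductSpace ComplexConjugate ContinuousMap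
open Filter Set Function TopologicalSpace MeasureTheory

attribute [summit_statement] _root_.PercolationContinuityZ3

/-- item stmt-CriticalPhenomena-4444 · crux · rank 2 · open · by planner
why it might fail: Fails iff annulus-spanning box-clusters proliferate at p_c(Z^3): TRUE for d>6 given eta=0 (Aizenman1997 Thm 4(3): N_L>=o(1)L^(d-6); Lean numSpanning_ge_tendsto_one; uncond. d>=11). d=3 tightness = BCKS postulate ('not clear for d=3,4,5', Aizenman Sec.1), numerics only (Sen 1996); no counting tool.
sources: Aizenman1997, BorgsChayesKestenSpencer1999, Cerf2015, DuminilcopinKozmaTassion2020, FitznerVanDerHofstad2017, HeydenreichVanDerHofstad2017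
[crux] at p_c(ℤ³) there are M ∈ ℕ and c > 0 such that for infinitely many n, with probability ≥ c at
most M distinct clusters of the open subgraph induced on B(2n) meet both B(n) and ∂⁻B(2n) (card item
r2, positive-probability form; the '1−ε tightness' and bounded-mean forms imply it). [difficulty:
open-problem] -/
@[route_item "route-CriticalPhenomena-PercNonProliferation"]
def NonProliferation : Prop :=
  ∃ (M : ℕ) (c : ℝ), 0 < c ∧ ∃ᶠ n : ℕ in Filter.atTop, c ≤ (Literature.Probability.Percolation.bondPercolation (Literature.Probability.LatticeModels.zdGraph 3) (Literature.Probability.Percolation.criticalProbI 3)).real {ω | ¬ ∃ x : Fin (M + 1) → Literature.Probability.LatticeModels.Site 3, (∀ i, x i ∈ Literature.Probability.LatticeModels.box 3 n) ∧ (∀ i, ∃ y ∈ Literature.Probability.LatticeModels.innerBoundary (Literature.Probability.LatticeModels.zdGraph 3) (Literature.Probability.LatticeModels.box 3 (2 * n)), ω ∈ Literature.Probability.Percolation.openConnIn ↑(Literature.Probability.LatticeModels.box 3 (2 * n)) (x i) y) ∧ ∀ i j, i ≠ j → ω ∉ Literature.Probability.Percolation.openConnIn ↑(Literature.Probability.LatticeModels.box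 3 (2 * n)) (x i) (x j)}

/-- item stmt-CriticalPhenomena-4445 · crux · rank 3 · closed · proved by Summit.CriticalPhenomena.PercolationContinuityZ3.Theorems.PercNonProliferationFreeBoxSparse.freeBoxSparse_proof @ 1922d85d9809 (prover) · by planner
why it might fail: Implied by theta(p_c)=0; fails iff a jump comes WITH free-box giants (|K_max^free|/|B_n| not->0; DKT2020 Sec.1.1 'many large clusters avoiding each other'). Hutchcroft2022 p.5 claims a 'not too difficult folklore theorem' - no proof located (2 audits + this pass); BGN/BK needs x_s+x_b>3/2 vs 1.45.
sources: Hutchcroft2022, arXiv:2202.07634, Hutchcroft2021, arXiv:2008.11197, DuminilcopinKozmaTassion2020, BarskyGrimmettNewman1991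
[crux] the pair-averaged free-box connectivity at p_c(ℤ³) vanishes: |B(n)|⁻² Σ_{x,y∈B(n)} P_{p_c}(x
↔ y inside B(n)) → 0 (card item r3 in L² form = the retired cards' J1/W1-qualitative; equivalent to
|K_max^free(B(n))|/|B(n)| → 0 in probability and to Hutchcroft's centred folklore E|K_{B(r)}(0)| =
o(r³); shared input of cards box-hyperscaling-gluing, hollow-cells-inbox-shattering,
critical-cluster-threshold-one). [difficulty: L] -/
@[route_item "route-CriticalPhenomena-PercNonProliferation"]
def FreeBoxSparse : Prop :=
  Filter.Tendsto (fun n : ℕ => (∑ x ∈ Literature.Probability.LatticeModels.box 3 n, ∑ y ∈ Literature.Probability.LatticeModels.box 3 n, (Literature.Probability.Percolation.bondPercolation (Literature.Probability.LatticeModels.zdGraph 3) (Literature.Probability.Percolation.criticalProbI 3)).real (Literature.Probability.Percolation.openConnIn ↑(Literature.Probability.LatticeModels.box 3 n) x y)) / ((Literature.Probability.LatticeModels.box 3 n).card : ℝ) ^ 2) Filter.atTop (nhds 0)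

/-- item stmt-CriticalPhenomena-4446 · crux · rank 4 · open · by planner
why it might fail: Fails iff u_n=P_pc(B(n) not<->d-B(2n) in B(2n)) <= n^-s on a subsequence: the d>6 world (crossing->1, ~n^(d-6) crossers; Lean annulusCrossing_tendsto_one). d=3: only 1-u_n>=c known; u_n>=c proved on slabs only, constants dying as k->oo (NewmanTassionWu2017 Cor 3.2); RSW-type bounds on Z^3 open.
sources: Aizenman1997, BorgsChayesKestenSpencer1999, NewmanTassionWu2017, DuminilcopinKozmaTassion2020, BenjaminiKalai2018, arXiv:1302.0421
[crux] the critical annulus-blocking probability decays slower than any power: for every s > 0,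
eventually P_{p_c}(no open path inside B(2n) from B(n) to ∂⁻B(2n)) ≥ n^{−s} (absorbed criterion C-b
of jump-forces-spanning-cluster-proliferation; strictly weaker than
PercAnnulusCrossing.CritAnnulusNonCrossing, which asks ≥ c; by BK it caps E[N_n] ≤ n^s).
[difficulty: open-problem] -/
@[route_item "route-CriticalPhenomena-PercNonProliferation"]
def SubpolynomialBlocking : Prop :=
  ∀ s : ℝ, 0 < s → ∀ᶠ n : ℕ in Filter.atTop, (n : ℝ) ^ (-s) ≤ (Literature.Probability.Percolation.bondPercolation (Literature.Probability.LatticeModels.zdGraph 3) (Literature.Probability.Percolation.criticalProbI 3)).real {ω | ¬ ∃ x ∈ Literature.Probability.LatticeModels.box 3 n, ∃ y ∈ Literature.Probability.LatticeModels.innerBoundary (Literature.Probability.LatticeModels.zdGraph 3) (Literature.Probability.LatticeModels.box 3 (2 * n)), ω ∈ Literature.Probability.Percolation.openConnIn ↑(Literature.Probability.LatticeModels.box 3 (2 * n)) x y}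

/-- item stmt-CriticalPhenomena-4447 · crux · rank 5 · open · by planner
why it might fail: Stronger than FreeBoxSparse (rate a>0; predicted a=1+eta~0.95): false in a jump world with free-box giants; even given theta(p_c)=0 no rate for box-restricted connectivity is known in d=3; visible proof (lowest point+BK+BGN half-space mass) needs x_s+x_b>3/2 vs 1.452 (Deng-Blote x_s=0.975).
sources: Hutchcroft2022, arXiv:2202.07634, doi:10.1103/physreve.71.016117, arXiv:1810.03750, ChatterjeeHanson2020, arXiv:1302.0421
[crux] a power saving for the free-box pair average at p_c(ℤ³): ∃ a > 0, C with |B(n)|⁻²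
Σ_{x,y∈B(n)} P_{p_c}(x ↔ y inside B(n)) ≤ C n^{−a} for n ≥ 1 (absorbed W1 of
jump-forces-spanning-cluster-proliferation; prediction a = 1+η ≈ 0.95; strengthens FreeBoxSparse and
is weaker than PercTwoPointDecay's bulk X_A). [deps: FreeBoxSparse] [difficulty: L] -/
@[route_item "route-CriticalPhenomena-PercNonProliferation"]
def FreeBoxPowerSaving : Prop :=
  ∃ a C : ℝ, 0 < a ∧ ∀ n : ℕ, 1 ≤ n → (∑ x ∈ Literature.Probability.LatticeModels.box 3 n, ∑ y ∈ Literature.Probability.LatticeModels.box 3 n, (Literature.Probability.Percolation.bondPercolation (Literature.Probability.LatticeModels.zdGraph 3) (Literature.Probability.Percolation.criticalProbI 3)).real (Literature.Probability.Percolation.openConnIn ↑(Literature.Probability.LatticeModels.box 3 n) x y)) / ((Literature.Probability.LatticeModels.box 3 n).card : ℝ) ^ 2 ≤ C * (n : ℝ) ^ (-a)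

/-- item stmt-CriticalPhenomena-14737 · support · rank 9 · closed · proved by Summit.CriticalPhenomena.PercolationContinuityZ3.Theorems.polynomialPairGivesSparse_proof @ 7283d719d6fa (prover) · by planner
sources: Hutchcroft2022, BorgsChayesKestenSpencer1999, Aizenman1997
[support] glue (route-repair unused-crux, 2026-08-16): the polynomial pair feeds the closes
hypothesis FreeBoxSparse — FreeBoxPowerSaving → SubpolynomialBlocking → FreeBoxSparse. True and
provable now, two ways: (i) squeeze from the power saving alone, 0 ≤ FA₂(n) ≤ C·n^(−a) → 0
(SubpolynomialBlocking idle; candidate proof attached as evidence, ~15 lines); (ii) through the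
pair's own assembly — PolynomialAssembly (proved, polynomialAssembly_proof) with MeanCauchySchwarz
and SpanningBKCap (both proved) gives θ(p_c) = 0, and continuity ⇒ sparsity (τ_pc(x,y) ≤ θ_k(p_c) ↓
θ(p_c) = 0 for |x−y|∞ > k; pairs at distance ≤ k are O(k³/|B(n)|)). Purpose: records INSIDE the cone
of `closes` (which stays on the main line FreeBoxSparse ∧ NonProliferation, all its supports and
Assembly proved) that r4 SubpolynomialBlocking and r5 FreeBoxPowerSaving are an alternative
sufficient pair: with PolynomialAssembly they decide the conjunct outright, but that item's head is
the Statement, not a route decl, so the cone parser cannot see it. The faithful long-term shape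
(D-0019: an alternative decomposition is a separate route) is a sibling route for the polynomial
pair sharing r4, r5, MeanCauchySchwarz, Spa -/
@[route_item "route-CriticalPhenomena-PercNonProliferation"]
def PolynomialPairGivesSparse : Prop :=
  FreeBoxPowerSaving → SubpolynomialBlocking → FreeBoxSparse

/-- item stmt-CriticalPhenomena-4448 · support · rank 9 · closed · proved by Summit.CriticalPhenomena.PercolationContinuityZ3.Theorems.spanningPiecesCount_proof (prover) · by planner
sources: AizenmanDuminilCopinSidoraviciusCMP2015, Aizenman1997
[support] deterministic Cauchy–Schwarz over spanning pieces: for a configuration using lattice edges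
only, if no M+1 points of B(n) are pairwise unjoined inside B(2n) and each joined inside B(2n) to
∂⁻B(2n), then (#{x ∈ B(n) : |C(x)| = ∞})² ≤ M · #{(x,y) ∈ B(n)² : x ↔ y inside B(2n)} (every
percolating point of B(n) is a spanning representative since an infinite open path leaves B(2n)
through ∂⁻B(2n); percolating points fall into ≤ M classes; (Σ_r |P_r|)² ≤ M Σ_r |P_r|²).
[difficulty: provable-now] -/
@[route_item "route-CriticalPhenomena-PercNonProliferation"]
def SpanningPiecesCount : Prop :=
  ∀ (M n : ℕ) (ω : Literature.Probability.Percolation.BondConfig (Literature.Probability.LatticeModels.Site 3)), ω ⊆ (Literature.Probability.LatticeModels.zdGraph 3).edgeSet → (¬ ∃ x : Fin (M + 1) → Literature.Probability.LatticeModels.Site 3, (∀ i, x i ∈ Literature.Probability.LatticeModels.box 3 n) ∧ (∀ i, ∃ y ∈ Literature.Probability.LatticeModels.innerBoundary (Literature.Probability.LatticeModels.zdGraph 3) (Literature.Probability.LatticeModels.box 3 (2 * n)), ω ∈ Literature.Probability.Percolation.openConnIn ↑(Literature.Probability.LatticeModels.box 3 (2 * n)) (x i) y) ∧ ∀ i j,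 i ≠ j → ω ∉ Literature.Probability.Percolation.openConnIn ↑(Literature.Probability.LatticeModels.box 3 (2 * n)) (x i) (x j)) → (((Literature.Probability.LatticeModels.box 3 n).filter fun x => ω ∈ Literature.Probability.Percolation.percolatesAt x).card) ^ 2 ≤ M * ((Literature.Probability.LatticeModels.box 3 n ×ˢ Literature.Probability.LatticeModels.box 3 n).filter fun q => ω ∈ Literature.Probability.Percolation.openConnIn ↑(Literature.Probability.LatticeModels.box 3 (2 * n)) q.1 q.2).card

/-- item stmt-CriticalPhenomena-4449 · support · rank 9 · closed · proved by Summit.CriticalPhenomena.PercolationContinuityZ3.Theorems.densityWhp_proof (prover) · by planner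
sources: Grimmett1999, AizenmanDuminilCopinSidoraviciusCMP2015
[support] lower half of the L² ergodic theorem for the density of percolating sites, every p:
P_p(#{x ∈ B(n) : |C(x)| = ∞} ≥ θ(p)|B(n)|/2) → 1 (E V_n = θ|B(n)| by shift invariance,
bondPercolation_real_preimage_shift; Var V_n = o(|B(n)|²) because Cov(1{x↔∞},1{y↔∞}) ≤ 4(θ_k − θ)
for |x−y|_∞ > 2k+1 via the independent local events {x ↔ x+∂B(k)} and θ_k ↓ θ; Chebyshev).
[difficulty: provable-now] -/
@[route_item "route-CriticalPhenomena-PercNonProliferation"]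
def DensityWhp : Prop :=
  ∀ p : unitInterval, Filter.Tendsto (fun n : ℕ => (Literature.Probability.Percolation.bondPercolation (Literature.Probability.LatticeModels.zdGraph 3) p).real {ω | Literature.Probability.Percolation.theta (Literature.Probability.LatticeModels.zdGraph 3) 0 p * ((Literature.Probability.LatticeModels.box 3 n).card : ℝ) / 2 ≤ (((Literature.Probability.LatticeModels.box 3 n).filter fun x => ω ∈ Literature.Probability.Percolation.percolatesAt x).card : ℝ)}) Filter.atTop (nhds 1)

/-- item stmt-CriticalPhenomena-4450 · support · rank 9 · closed · proved by Summit.CriticalPhenomena.PercolationContinuityZ3.Theorems.meanCauchySchwarz_proof (prover) · by planner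
sources: AizenmanDuminilCopinSidoraviciusCMP2015, Aizenman1997
[support] the free-box cousin of the ADS density bound, every p and n: (θ(p)|B(n)|)² ≤ E_p[N_n] ·
E_p[S_n], where E_p[N_n] = Σ_{k<|B(n)|} P_p(∃ k+1 points of B(n) pairwise unjoined inside B(2n),
each joined inside B(2n) to ∂⁻B(2n)) and E_p[S_n] = Σ_{x,y∈B(n)} P_p(x ↔ y inside B(2n)) (pointwise
V² ≤ N·S a.s. as in SpanningPiecesCount, then E V ≤ (E[V²/S])^{1/2} (E S)^{1/2} and V²/S ≤ N; no
FKG, no uniqueness, no ergodic theorem; absorbed (W1) of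
jump-forces-spanning-cluster-proliferation). [difficulty: provable-now] -/
@[route_item "route-CriticalPhenomena-PercNonProliferation"]
def MeanCauchySchwarz : Prop :=
  ∀ (p : unitInterval) (n : ℕ), (Literature.Probability.Percolation.theta (Literature.Probability.LatticeModels.zdGraph 3) 0 p * ((Literature.Probability.LatticeModels.box 3 n).card : ℝ)) ^ 2 ≤ (∑ k ∈ Finset.range (Literature.Probability.LatticeModels.box 3 n).card, (Literature.Probability.Percolation.bondPercolation (Literature.Probability.LatticeModels.zdGraph 3) p).real {ω | ∃ x : Fin (k + 1) → Literature.Probability.LatticeModels.Site 3, (∀ i, x i ∈ Literature.Probability.LatticeModels.box 3 n) ∧ (∀ i, ∃ y ∈ Literature.Probability.LatticeModels.innerBoundary (Literature.Probability.LatticeModels.zdGraph 3) (Literature.Probability.LatticeModels.box 3 (2 * n)), ω ∈ Literature.Probability.Percolation.openConnIn ↑(Literature.Probability.LatticeModels.box 3 (2 * n)) (x i) y) ∧ ∀ i j, i ≠ j → ω ∉ Literature.Probability.Percolation.openConnIn ↑(Literature.Probability.LatticeModels.box 3 (2 * n)) (x i) (x j)}) * ∑ x ∈ Literature.Probability.LatticeModels.box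 3 n, ∑ y ∈ Literature.Probability.LatticeModels.box 3 n, (Literature.Probability.Percolation.bondPercolation (Literature.Probability.LatticeModels.zdGraph 3) p).real (Literature.Probability.Percolation.openConnIn ↑(Literature.Probability.LatticeModels.box 3 (2 * n)) x y)

/-- item stmt-CriticalPhenomena-4451 · support · rank 9 · closed · proved by Summit.CriticalPhenomena.PercolationContinuityZ3.Theorems.spanningBKCap_proof (prover) · by planner
sources: Grimmett1999, ReimerCPC2000, Aizenman1997
[support] BK cap on the spanning count, every p, k, n: P_p(∃ k+1 points of B(n) pairwise unjoined
inside B(2n), each joined inside B(2n) to ∂⁻B(2n)) ≤ P_p(B(n) ↔ ∂⁻B(2n) inside B(2n))^{k+1}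
(distinct box-clusters carry vertex-disjoint crossing paths = pairwise disjoint witnesses of the
increasing finitary crossing event; Literature.Probability.Percolation.bk_finitary_list with
mem_disjointOccurrenceList_of_pairwise_disjoint). [difficulty: provable-now] -/
@[route_item "route-CriticalPhenomena-PercNonProliferation"]
def SpanningBKCap : Prop :=
  ∀ (p : unitInterval) (k n : ℕ), (Literature.Probability.Percolation.bondPercolation (Literature.Probability.LatticeModels.zdGraph 3) p).real {ω | ∃ x : Fin (k + 1) → Literature.Probability.LatticeModels.Site 3, (∀ i, x i ∈ Literature.Probability.LatticeModels.box 3 n) ∧ (∀ i, ∃ y ∈ Literature.Probability.LatticeModels.innerBoundary (Literature.Probability.LatticeModels.zdGraph 3) (Literature.Probability.LatticeModels.box 3 (2 * n)), ω ∈ Literature.Probability.Percolation.openConnIn ↑(Literature.Probability.LatticeModels.box 3 (2 * n)) (x i) y) ∧ ∀ i j, i ≠ j → ω ∉ Literature.Probability.Percolation.openConnIn ↑(Literature.Probability.LatticeModels.box 3 (2 * n)) (x i) (x j)} ≤ ((Literature.Probability.Percolation.bondPercolation (Literature.Probability.LatticeModels.zdGraph 3) p).real {ω | ∃ x ∈ Literature.Probability.LatticeModels.box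 3 n, ∃ y ∈ Literature.Probability.LatticeModels.innerBoundary (Literature.Probability.LatticeModels.zdGraph 3) (Literature.Probability.LatticeModels.box 3 (2 * n)), ω ∈ Literature.Probability.Percolation.openConnIn ↑(Literature.Probability.LatticeModels.box 3 (2 * n)) x y}) ^ (k + 1)

/-- item stmt-CriticalPhenomena-4458 · support · rank 9 · closed · proved by Summit.CriticalPhenomena.PercolationContinuityZ3.Theorems.polynomialAssembly_proof (prover) · by planner
sources: BorgsChayesKestenSpencer1999, Aizenman1997
[support] glue of the polynomial pair: MeanCauchySchwarz → SpanningBKCap → FreeBoxPowerSaving →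
SubpolynomialBlocking → θ(p_c) = 0 (at p_c with s := a/2: E[N_n] ≤ Σ_k (1−u_n)^{k+1} ≤ 1/u_n ≤
n^{a/2}, E[S_n] ≤ Σ_{x,y∈B(2n)} P(x ↔ y inside B(2n)) ≤ 64 C 2^{−a} n^{−a} |B(n)|², so θ(p_c)² ≤ 64
C n^{−a/2} → 0). [difficulty: provable-now] -/
@[route_item "route-CriticalPhenomena-PercNonProliferation"]
def PolynomialAssembly : Prop :=
  MeanCauchySchwarz → SpanningBKCap → FreeBoxPowerSaving → SubpolynomialBlocking → PercolationContinuityZ3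

/-- item stmt-CriticalPhenomena-4459 · assembly · rank 1 · closed · proved by Summit.CriticalPhenomena.PercolationContinuityZ3.Theorems.nonProlifAssembly_proof (prover) · by planner
sources: Aizenman1997, AizenmanDuminilCopinSidoraviciusCMP2015, Grimmett1999
[assembly] SpanningPiecesCount → DensityWhp → FreeBoxSparse → NonProliferation →
PercolationContinuityZ3. -/
@[route_item "route-CriticalPhenomena-PercNonProliferation"]
def Assembly : Prop :=
  SpanningPiecesCount → DensityWhp → FreeBoxSparse → NonProliferation → PercolationContinuityZ3

/-! D-0027 §2.1 — DECIDING THEOREM (planner-authored via `route open/edit --closes-file`; by planner-rbadge-CriticalPhenomena-PercNonProlif-bde3ba00-g4-0 2026-08-15T16:11:42Z):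
its hypotheses are this route's items and its conclusion the sub-problem Statement (glue_lint), and it elaborates with this file. -/

@[closes "route-CriticalPhenomena-PercNonProliferation"] theorem closes (hCount : SpanningPiecesCount) (hDensity : DensityWhp) (hSparse : FreeBoxSparse)
    (hNonProlif : NonProliferation) (hAssembly : Assembly) : _root_.PercolationContinuityZ3 :=
  hAssembly hCount hDensity hSparse hNonProlif

end Summit.CriticalPhenomena.PercolationContinuityZ3.Theses.PercNonProliferation
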